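import Summits.Ventures.QEC.Census.CertTwoBlockShift
import HarnessLib

/-!
# The two-block shift lane, v2: the CYCLIC-WINDOW refinement — definitions and checks (qec-type-01 gen 5)

Companion of `Census/CertTwoBlockShift.lean` (01.TBSHIFT, PARTITION item 133). There, a light-block support is translated so
that it contains the forced free column `p₀`; the light rows are ALL other free light columns. Here the translation is CHOSEN:
along one cyclic factor `ℤ_m` of the block's translation group (coordinate table `dig`, one digit per light column) a support of
`≤ t` points leaves a cyclic gap of `≥ ⌈m/t⌉` digits, so some support point `r` can be moved to `p₀` with EVERY other support point
landing in the WINDOW of relative digit `≤ W`, `W = m − ⌈m/t⌉` (precisely: any `W` with `t·(m − W − 1) < m`). The light rows shrink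
to the free light columns inside the window: `C(R_W, ≤ t−1)` lanes per coset word instead of `C(R, ≤ t−1)` — e.g. `ℤ_66`, `t = 6`:
`C(54, ≤5) = 3.5·10⁶` instead of `C(65, ≤5) = 9.0·10⁶`. With `m = 1, W = 0, dig = []` this is exactly v1.

This file: the window data `ShiftWin`, the predicates `digOf` / `winOK`, the windowed rows `lightColsW` / `lightRowsW`, the per-word
digit-translation check `tabWinOK`, the checks `ShiftHalf.structOKW` / `ShiftSideW.structOK`. Soundness (the counting lemma
`exists_shift_window` over `ZMod m`, `half_soundW`, `shift_lower_soundW`, `DistCert.lowZ_of_shiftW`) in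
`CertTwoBlockShiftWindowSound.lean`. HONEST FRAMING: infrastructure; no certificate is read and no distance is asserted here. Tier KERNEL,
axioms standard, no `native_decide`. [folklore] (pigeonhole on cyclic gaps; automorphism reduction as in Grassl 2006 §2.2.)
-/

set_option autoImplicit false

namespace Summit.Ventures.QEC.Census

open List

/-- The window data of a half: the modulus `m` of the chosen cyclic factor, the window bound `W`, and the digit table of the
light block (`dig[u]` = the `ℤ_m`-coordinate of light column `lo + u`). (structure) -/
structure ShiftWin where
  /-- modulus of the cyclic factor (`1` = no window) -/
  m : ℕ
  /-- window bound on the relative digit -/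
  W : ℕ
  /-- digit table of the light block -/
  dig : List ℕ

namespace ShiftHalf

variable (h : ShiftHalf) (w : ShiftWin)

/-- The digit of light column `q`. (definition) -/
def digOf (q : ℕ) : ℕ := w.dig.getD (q - h.lo) 0

/-- In the window: the digit of `q` relative to the digit of `p₀` is `≤ W` (computed in `ℕ`, all digits reduced mod `m`). (definition) -/
def winOK (q : ℕ) : Bool := decide ((h.digOf w q % w.m + (w.m - h.digOf w h.p0 % w.m)) % w.m ≤ w.W)

/-- The windowed light columns: free, in the light block, not `p₀`, inside the window — increasing. (definition) -/
def lightColsW (n : ℕ) : List ℕ :=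
  (List.range n).filter fun q => h.inL q && !(h.ic.piv.elem q) && !(q == h.p0) && h.winOK w q

/-- The windowed enumeration matrix (without the forced row). (definition) -/
def lightRowsW (n : ℕ) : List ℕ := (h.lightColsW w n).map (kerVec h.ic.piv h.ic.red)

/-- **The digit-translation check of one word table** for light column `p`: on the light block the table shifts the digit by
`s_p = dig p₀ − dig p (mod m)`. (definition) -/
def tabWinOK (tab : List ℕ) (p : ℕ) : Bool :=
  (List.range (h.hi - h.lo)).all fun u =>
    h.digOf w (permFun tab (h.lo + u)) % w.m ==
      (h.digOf w (h.lo + u) % w.m + (h.digOf w h.p0 % w.m + (w.m - h.digOf w p % w.m))) % w.m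

/-- **The windowed structural check of a half**: the v1 check `structOK`, `1 ≤ m`, the gap inequality `t·(m − W − 1) < m`, and the
digit-translation check of every word. (definition, `decide`) -/
def structOKW (n : ℕ) (Hsyn : List ℕ) (gens : List AutGen) (t : ℕ) : Bool :=
  h.structOK n Hsyn gens && decide (1 ≤ w.m) && decide (t * (w.m - w.W - 1) < w.m) &&
    (List.range (h.hi - h.lo)).all fun i => h.tabWinOK w (wordPerm n (autPerms gens) (h.words.getD i [])) (h.lo + i)

end ShiftHalf

/-- The windowed lane's data for one side: generators, the two halves with their windows, the light budget `t`. (structure) -/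
structure ShiftSideW where
  /-- automorphism generators (qec-type-12 `AutGen`) -/
  gens : List AutGen
  /-- half with light block `B₁` -/
  A : ShiftHalf
  /-- its window -/
  wA : ShiftWin
  /-- half with light block `B₂` -/
  B : ShiftHalf
  /-- its window -/
  wB : ShiftWin
  /-- light budget: `wmax ≤ 2t + 1` -/
  t : ℕ

/-- **The two-half check (windowed)**: both halves' windowed checks, complementary light blocks on `[0, n)`, `wmax ≤ 2t + 1`.
(definition, `decide`) -/
def ShiftSideW.structOK (s : ShiftSideW) (n : ℕ) (Hsyn : List ℕ) (wmax : ℕ) : Bool :=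
  s.A.structOKW s.wA n Hsyn s.gens s.t && s.B.structOKW s.wB n Hsyn s.gens s.t &&
    ((List.range n).all fun q => s.B.inL q == !(s.A.inL q)) && decide (wmax ≤ 2 * s.t + 1)

/-! ## Controls (tier KERNEL, `decide`) -/

/-- A toy half on `8` qubits (light block `[0,4)` = `ℤ_4`, identity RREF data irrelevant here): with `m = 4`, `W = 2`, digits
`[0,1,2,3]` and `p₀ = 0`, columns `0,1,2` are in the window and column `3` is not. -/
theorem winOK_toy :
    (let h : ShiftHalf := ⟨0, 4, ⟨[], [], []⟩, 0, []⟩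
     let w : ShiftWin := ⟨4, 2, [0, 1, 2, 3]⟩
     [h.winOK w 0, h.winOK w 1, h.winOK w 2, h.winOK w 3]) = [true, true, true, false] := by decide

/-- The trivial window (`m = 1`, `W = 0`, no digits) accepts every column. -/
theorem winOK_trivial (h : ShiftHalf) (q : ℕ) : h.winOK ⟨1, 0, []⟩ q = true := by
  simp [ShiftHalf.winOK, Nat.mod_one]

end Summit.Ventures.QEC.Census
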